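import Summits.NavierStokesRegularity.TurbBounds.SpectralForm
import Summits.NavierStokesRegularity.TurbBounds.TailTwoSided
import HarnessLib

/-!
# The full-gap mode form `Q_k` IS half the RB-type layer-variable form — link between `SpectralForm` (cited statement) and `rbForm` (certificates)
(cell `pub-turb` / `turb-bounds`; v2 groundwork for the RB rows. Written by pub-turb-cert, prover-pub-turb-cert-g6-0.)

HONEST FRAMING: rigorous bounds for the stated PDE and boundary conditions; no claim about physical turbulence beyond the bound.
PROVED: under the affine change of variable `z = (x + 1)/2` (gap `z ∈ [0, 1]` ↦ layer variable `x ∈ [-1, 1]`; rbsdp SPEC 3.3),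
for `w ∈ C²`, `θ ∈ C¹`: `modeForm Ra s τ′ k w θ = ½ · rbForm ((s−1)/Ra) s (x ↦ s·τ′((x+1)/2)) (k²) (w ∘ ·) (θ ∘ ·)`
(`modeForm_eq_half_rbForm`), the two-sided gap class maps into the two-sided layer class (`twoSidedX_of_twoSided`), hence
`spectralConstraint_of_rbPositivity`: positivity of the RB-type form on the two-sided class for every `K > 0` implies the spectral
constraint (A1) `SpectralConstraint Ra s τ′` of the cited reduction. Pure calculus; no certificate data.
-/

set_option linter.style.longLine false

noncomputable section

namespace Summit.NavierStokesRegularity.TurbBounds.RBSpectralLink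

open MeasureTheory intervalIntegral Set
open Summit.NavierStokesRegularity.TurbBounds.SpectralForm
open Summit.NavierStokesRegularity.TurbBounds.TailPolyGenW (rbIntegrand rbForm)
open Summit.NavierStokesRegularity.TurbBounds.TailTwoSided

/-- the affine map `x ↦ (x + 1)/2` has derivative `1/2` -/
theorem hasDerivAt_half (x : ℝ) : HasDerivAt (fun y : ℝ => (y + 1) / 2) (1 / 2) x := by
  have h := ((hasDerivAt_id x).add_const (1 : ℝ)).div_const 2
  simpa using h

/-- chain rule through `x ↦ (x + 1)/2` -/
theorem hasDerivAt_comp_half {f : ℝ → ℝ} {f' x : ℝ} (hf : HasDerivAt f f' ((x + 1) / 2)) :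
    HasDerivAt (fun y => f ((y + 1) / 2)) (f' / 2) x := by
  have h := hf.comp x (hasDerivAt_half x)
  have e : f' * (1 / 2) = f' / 2 := by ring
  rw [e] at h
  exact h

/-- first derivative of `w ∘ ((·+1)/2)` for differentiable `w` -/
theorem deriv_comp_half {f : ℝ → ℝ} (hf : Differentiable ℝ f) :
    deriv (fun y => f ((y + 1) / 2)) = fun y => deriv f ((y + 1) / 2) / 2 := by
  funext y
  exact (hasDerivAt_comp_half (hf _).hasDerivAt).deriv

/-- second derivative of `w ∘ ((·+1)/2)` for `w` with differentiable derivative -/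
theorem deriv_deriv_comp_half {f : ℝ → ℝ} (hf : Differentiable ℝ f) (hf' : Differentiable ℝ (deriv f)) :
    deriv (deriv (fun y => f ((y + 1) / 2))) = fun y => deriv (deriv f) ((y + 1) / 2) / 4 := by
  rw [deriv_comp_half hf]
  funext y
  have h := (hasDerivAt_comp_half (hf' ((y + 1) / 2)).hasDerivAt).div_const 2
  rw [h.deriv]; ring

/-- The RB integrand of the pulled-back fields at `x` is the mode integrand at `z = (x+1)/2` (weights `A = (s−1)/Ra`, `B = s`, `K = k²`,
coupling `g = s·τ′`). -/
theorem rbIntegrand_comp_half {Ra s k : ℝ} {τp w θ : ℝ → ℝ} (hw : ContDiff ℝ 2 w) (hθ : ContDiff ℝ 1 θ) (x : ℝ) :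
    rbIntegrand ((s - 1) / Ra) s (fun y => s * τp ((y + 1) / 2)) (k ^ 2) (fun y => w ((y + 1) / 2)) (fun y => θ ((y + 1) / 2)) x
      = modeIntegrand Ra s τp k w θ ((x + 1) / 2) := by
  have hwd : Differentiable ℝ w := hw.differentiable (by norm_num)
  have hw1d : Differentiable ℝ (deriv w) := by
    have h := hw.differentiable_iteratedDeriv 1 (by norm_num)
    rwa [iteratedDeriv_one] at h
  have hθd : Differentiable ℝ θ := hθ.differentiable (by norm_num)
  simp only [rbIntegrand, modeIntegrand]
  rw [deriv_deriv_comp_half hwd hw1d, deriv_comp_half hwd, deriv_comp_half hθd]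
  ring

/-- **`Q_k = ½ · rbForm` under `z = (x+1)/2`.** -/
theorem modeForm_eq_half_rbForm {Ra s k : ℝ} {τp w θ : ℝ → ℝ} (hw : ContDiff ℝ 2 w) (hθ : ContDiff ℝ 1 θ) :
    modeForm Ra s τp k w θ
      = (1 / 2) * rbForm ((s - 1) / Ra) s (fun y => s * τp ((y + 1) / 2)) (k ^ 2) (fun y => w ((y + 1) / 2)) (fun y => θ ((y + 1) / 2)) := by
  unfold rbForm modeForm
  simp_rw [rbIntegrand_comp_half hw hθ]
  have hsub : (∫ x in (-1 : ℝ)..1, modeIntegrand Ra s τp k w θ ((x + 1) / 2))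
      = ∫ x in (-1 : ℝ)..1, modeIntegrand Ra s τp k w θ ((1 / 2) * x + 1 / 2) :=
    intervalIntegral.integral_congr fun x _ => by ring_nf
  rw [hsub, intervalIntegral.integral_comp_mul_add (fun z => modeIntegrand Ra s τp k w θ z) (by norm_num : (1 / 2 : ℝ) ≠ 0) (1 / 2)]
  have e1 : (1 / 2 : ℝ) * (-1) + 1 / 2 = 0 := by norm_num
  have e2 : (1 / 2 : ℝ) * 1 + 1 / 2 = 1 := by norm_num
  rw [e1, e2, smul_eq_mul]
  ring

/-- The pull-back of a two-sided gap pair is a two-sided layer pair. -/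
theorem twoSidedX_of_twoSided {w θ : ℝ → ℝ} (h : TwoSided w θ) :
    TwoSidedX (fun y => w ((y + 1) / 2)) (fun y => θ ((y + 1) / 2)) := by
  have hwd : Differentiable ℝ w := h.hw.differentiable (by norm_num)
  have hφ : ContDiff ℝ 2 (fun y : ℝ => (y + 1) / 2) := by fun_prop
  have hφ1 : ContDiff ℝ 1 (fun y : ℝ => (y + 1) / 2) := by fun_prop
  refine ⟨h.hw.comp hφ, h.hθ.comp hφ1, ?_, ?_, ?_, ?_, ?_, ?_⟩
  · norm_num [h.w_bot]
  · rw [deriv_comp_half hwd]; norm_num [h.dw_bot]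
  · norm_num [h.w_top]
  · rw [deriv_comp_half hwd]; norm_num [h.dw_top]
  · norm_num [h.θ_bot]
  · norm_num [h.θ_top]

/-- **RB positivity ⇒ spectral constraint (A1).** If the RB-type form with weights `((s−1)/Ra, s)` and coupling `x ↦ s·τ′((x+1)/2)` is
`≥ 0` on the two-sided layer class for every `K > 0`, then `Q_k ≥ 0` for every `k > 0` on the two-sided gap class. -/
theorem spectralConstraint_of_rbPositivity {Ra s : ℝ} {τp : ℝ → ℝ}
    (h : RBPositivity ((s - 1) / Ra) s (fun y => s * τp ((y + 1) / 2))) : SpectralConstraint Ra s τp := by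
  intro k hk w θ hwθ
  rw [modeForm_eq_half_rbForm hwθ.hw hwθ.hθ]
  exact mul_nonneg (by norm_num) (h (k ^ 2) (by positivity) _ _ (twoSidedX_of_twoSided hwθ))

end Summit.NavierStokesRegularity.TurbBounds.RBSpectralLink

end
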